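import Mathlib

/-!
# The CM-Hermitian lift over cyclotomic fields, part 1: traces, embeddings, norm windows, reduction maps
(wall-breaker axis `Hermitian unital constructions`, stub `stub_tangencySets` of the crux `LevelOneGL2Designs`,
stmt-MatrixMultiplication-14080, k7 — file 3)

Elementary facts about a cyclotomic field `K ⊇ ℚ(ζ)`, `ζ` a primitive `r`-th root of unity, `r` prime, used by the
CM-Hermitian lift `…HermitianLiftCyclotomic`:

* `trace_zeta_pow_eq_neg_one` — `Tr_{K/ℚ}(ζⁱ) = −1` for `0 < i < r` (the minimal polynomial of a primitive `r`-th root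
  is `1 + X + ⋯ + X^{r−1}`);
* `norm_embedding_zeta`, `norm_embedding_intComb_le` — under every embedding `τ : K → ℂ`, `‖τ ζ‖ = 1` and an integer
  combination `Σ cᵢ ζ^{eᵢ}` has `‖τ(Σ cᵢ ζ^{eᵢ})‖ ≤ Σ |cᵢ|` (the archimedean size of a "box" element);
* `natAbs_norm_lt_of_forall_embedding` — for ANY number field: if `‖τ F‖ ≤ B` for all embeddings and `B^{[K:ℚ]} < p`
  then `|N_{K/ℚ}(F)| < p` (`N = ∏_τ τ F`) — the norm WINDOW through which reduction mod `p` is injective;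
* `exists_isPrimitiveRoot_zmod`, `exists_ringHom_ringOfIntegers_zmod` — for a prime `p ≡ 1 (mod r)` there is a
  primitive `r`-th root of unity in `ZMod p`, hence a ring map `𝓞 K → ZMod p` (`p` splits completely in `ℚ(ζ_r)`;
  via Mathlib's integral power basis `IsPrimitiveRoot.integralPowerBasis` and `PowerBasis.lift`).

No definitions.
-/

-- the summit/problem path `MatrixMultiplication.MatrixMultiplication` is fixed by the tree layout (D-0017)
set_option linter.dupNamespace false

noncomputable section

open Finset Polynomial NumberField

namespace Summit.MatrixMultiplication.MatrixMultiplication.Theorems.LevelOneGL2Designs.HermitianLift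

/-! ## Traces of primitive roots of prime order -/

section Trace

variable {K : Type*} [Field K] {r : ℕ} [hr : Fact r.Prime]

/-- For `r` prime and `0 < i < r`, `ζⁱ` is again a primitive `r`-th root of unity. [elementary] -/
theorem isPrimitiveRoot_zeta_pow {ζ : K} (hζ : IsPrimitiveRoot ζ r) {i : ℕ} (hi : 0 < i) (hir : i < r) :
    IsPrimitiveRoot (ζ ^ i) r := by
  refine hζ.pow_of_coprime i ?_
  rw [Nat.coprime_comm, Nat.Prime.coprime_iff_not_dvd hr.out]
  intro h
  have := Nat.eq_zero_of_dvd_of_lt h hir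
  omega

/-- The next-to-leading coefficient of `Φ_r = 1 + X + ⋯ + X^{r−1}` (`r` prime) is `1`. [elementary] -/
theorem nextCoeff_cyclotomic_prime : (cyclotomic r ℚ).nextCoeff = 1 := by
  have h2 := hr.out.two_le
  rw [nextCoeff, natDegree_cyclotomic, Nat.totient_prime hr.out, if_neg (by omega), cyclotomic_prime,
    finsetSum_coeff]
  simp only [coeff_X_pow]
  rw [Finset.sum_ite_eq (Finset.range r) (r - 1 - 1) (fun _ => (1 : ℚ)), if_pos (Finset.mem_range.mpr (by omega))]

/-- **`Tr_{K/ℚ}(ζⁱ) = −1`** for a primitive `r`-th root of unity `ζ` in an `r`-th cyclotomic extension `K/ℚ`, `r` prime,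
`0 < i < r`: `ζⁱ` generates `K`, its minimal polynomial is `Φ_r = X^{r−1} + X^{r−2} + ⋯ + 1`, and the trace of a
generator is minus the next-to-leading coefficient. [elementary] -/
theorem trace_zeta_pow_eq_neg_one [CharZero K] [IsCyclotomicExtension {r} ℚ K] {ζ : K} (hζ : IsPrimitiveRoot ζ r) {i : ℕ}
    (hi : 0 < i) (hir : i < r) : Algebra.trace ℚ K (ζ ^ i) = -1 := by
  haveI : NeZero r := ⟨hr.out.ne_zero⟩
  have hμ := isPrimitiveRoot_zeta_pow hζ hi hir
  have h := PowerBasis.trace_gen_eq_nextCoeff_minpoly (hμ.powerBasis ℚ)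
  rw [IsPrimitiveRoot.powerBasis_gen] at h
  rw [h, ← cyclotomic_eq_minpoly_rat hμ hr.out.pos, nextCoeff_cyclotomic_prime]

end Trace

/-! ## Archimedean size under the complex embeddings -/

section Embedding

variable {K : Type*} [Field K] {r : ℕ}

/-- Under every embedding `τ : K → ℂ` a primitive `r`-th root of unity has absolute value `1` (`r ≠ 0`).
[elementary] -/
theorem norm_embedding_zeta {ζ : K} (hζ : IsPrimitiveRoot ζ r) (hr : r ≠ 0) (τ : K →+* ℂ) : ‖τ ζ‖ = 1 :=
  (hζ.map_of_injective τ.injective).norm'_eq_one hr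

/-- **Box elements are archimedeanly small**: for integers `cᵢ` and exponents `eᵢ`,
`‖τ(Σᵢ cᵢ ζ^{eᵢ})‖ ≤ Σᵢ |cᵢ|` under every embedding `τ : K → ℂ`. [elementary] -/
theorem norm_embedding_intComb_le {ζ : K} (hζ : IsPrimitiveRoot ζ r) (hr : r ≠ 0) (τ : K →+* ℂ) {m : ℕ}
    (c : Fin m → ℤ) (e : Fin m → ℕ) :
    ‖τ (∑ i, (c i : K) * ζ ^ (e i))‖ ≤ ∑ i, (|c i| : ℝ) := by
  rw [map_sum]
  refine le_trans (norm_sum_le _ _) (Finset.sum_le_sum fun i _ => ?_)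
  rw [map_mul, map_pow, map_intCast, norm_mul, norm_pow, norm_embedding_zeta hζ hr τ, one_pow, mul_one,
    Complex.norm_intCast]

end Embedding

/-! ## The norm window -/

section Window

/-- **The norm window.**  If `F ∈ 𝓞_K` (`K` any number field) has `‖τ F‖ ≤ B` under every complex embedding `τ` and
`B^{[K:ℚ]} < p`, then `|N_{K/ℚ}(F)| < p` — the norm is the product of the `[K:ℚ]` embeddings.  (Combined with
`Literature…eq_zero_of_map_eq_zero_of_natAbs_norm_lt`: reduction modulo a degree-one prime above `p` is injective on
such `F`.) [elementary] -/
theorem natAbs_norm_lt_of_forall_embedding {K : Type*} [Field K] [NumberField K] (F : 𝓞 K) {B : ℝ}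
    (h : ∀ τ : K →+* ℂ, ‖τ (F : K)‖ ≤ B) {p : ℕ} (hp : B ^ Module.finrank ℚ K < p) :
    (Algebra.norm ℤ F).natAbs < p := by
  classical
  -- the norm as a product over the embeddings
  have hprod : ((Algebra.norm ℚ (F : K) : ℚ) : ℂ) = ∏ σ : K →ₐ[ℚ] ℂ, σ (F : K) := by
    have := Algebra.norm_eq_prod_embeddings ℚ ℂ (F : K)
    rwa [eq_ratCast] at this
  have hnormC : ‖((Algebra.norm ℚ (F : K) : ℚ) : ℂ)‖ ≤ B ^ Module.finrank ℚ K := by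
    rw [hprod, norm_prod, ← AlgHom.card ℚ K ℂ, ← Finset.card_univ, ← Finset.prod_const]
    refine Finset.prod_le_prod (fun σ _ => norm_nonneg _) fun σ _ => ?_
    exact h (σ : K →+* ℂ)
  -- `|N| ≤ B^n < p` in `ℝ`
  have hreal : ((Algebra.norm ℤ F).natAbs : ℝ) ≤ B ^ Module.finrank ℚ K := by
    rw [Nat.cast_natAbs, Int.cast_abs]
    have h1 : ‖((Algebra.norm ℚ (F : K) : ℚ) : ℂ)‖ = |((Algebra.norm ℤ F : ℤ) : ℝ)| := by
      rw [← Algebra.coe_norm_int, Complex.norm_ratCast, Rat.cast_intCast]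
    rw [← h1]
    exact hnormC
  exact_mod_cast lt_of_le_of_lt hreal hp

end Window

/-! ## Reduction maps `𝓞 K → ZMod p` for `p ≡ 1 (mod r)` -/

section Reduction

variable {r : ℕ} [hr : Fact r.Prime] {p : ℕ} [hp : Fact p.Prime]

/-- For primes `r` and `p ≡ 1 (mod r)` there is a primitive `r`-th root of unity in `ZMod p` (a suitable power of a
generator of the cyclic group `(ZMod p)ˣ` of order `p − 1`). [elementary] -/
theorem exists_isPrimitiveRoot_zmod (hmod : p % r = 1) : ∃ θ : ZMod p, IsPrimitiveRoot θ r := by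
  have hP := hp.out
  have hr2 := hr.out.two_le
  obtain ⟨g, hg⟩ := IsCyclic.exists_generator (α := (ZMod p)ˣ)
  have hord : orderOf g = p - 1 := by
    rw [orderOf_eq_card_of_forall_mem_zpowers hg, Nat.card_eq_fintype_card, ZMod.card_units]
  have hdvd : r ∣ p - 1 := by
    have := Nat.div_add_mod p r
    exact ⟨p / r, by omega⟩
  have hp1 : p - 1 ≠ 0 := by have := hP.two_le; omega
  set u : (ZMod p)ˣ := g ^ ((p - 1) / r) with hu
  have hne : (p - 1) / r ≠ 0 := by
    intro h0
    have := Nat.div_mul_cancel hdvd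
    rw [h0, zero_mul] at this
    exact hp1 this.symm
  have hou : orderOf u = r := by
    rw [hu, orderOf_pow' g hne, hord, Nat.gcd_eq_right (Nat.div_dvd_of_dvd hdvd), Nat.div_div_self hdvd hp1]
  refine ⟨(u : ZMod p), ?_⟩
  rw [IsPrimitiveRoot.coe_units_iff, ← hou]
  exact IsPrimitiveRoot.orderOf u

variable {K : Type*} [Field K] [CharZero K] [IsCyclotomicExtension {r} ℚ K]

/-- **`p ≡ 1 (mod r)` splits completely in `ℚ(ζ_r)`**: for such primes there is a ring homomorphism `𝓞 K → ZMod p`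
(`K` an `r`-th cyclotomic field) — lift the integral power basis generated by `ζ` (minimal polynomial `Φ_r`) to a
primitive `r`-th root of unity of `ZMod p`. [elementary] -/
theorem exists_ringHom_ringOfIntegers_zmod {ζ : K} (hζ : IsPrimitiveRoot ζ r) (hmod : p % r = 1) :
    Nonempty (𝓞 K →+* ZMod p) := by
  haveI : NeZero r := ⟨hr.out.ne_zero⟩
  obtain ⟨θ, hθ⟩ := exists_isPrimitiveRoot_zmod (r := r) (p := p) hmod
  -- `p ≠ r`, so `r ≠ 0` in `ZMod p`
  have hpr : (r : ZMod p) ≠ 0 := by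
    rw [Ne, ZMod.natCast_eq_zero_iff]
    intro h
    have hle : p ≤ r := Nat.le_of_dvd hr.out.pos h
    have : r ≤ p := by
      have := Nat.mod_lt p hr.out.pos
      have := Nat.div_add_mod p r
      by_contra hcon
      push Not at hcon
      rw [Nat.mod_eq_of_lt hcon] at hmod
      exact absurd hmod (by have := hp.out.two_le; omega)
    have hpeq : p = r := le_antisymm hle this
    rw [hpeq, Nat.mod_self] at hmod
    exact absurd hmod (by omega)
  haveI : NeZero (r : ZMod p) := ⟨hpr⟩
  have hroot : (cyclotomic r (ZMod p)).IsRoot θ := isRoot_cyclotomic_iff.mpr hθ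
  -- the minimal polynomial of the generator of the integral power basis is `Φ_r`
  let pb := hζ.integralPowerBasis
  have hgen : pb.gen = hζ.toInteger := hζ.integralPowerBasis_gen
  have hmin : minpoly ℤ pb.gen = cyclotomic r ℤ := by
    rw [hgen, ← NumberField.RingOfIntegers.minpoly_coe, show ((hζ.toInteger : 𝓞 K) : K) = ζ from rfl,
      cyclotomic_eq_minpoly hζ hr.out.pos]
  have haeval : aeval θ (minpoly ℤ pb.gen) = 0 := by
    rw [hmin, aeval_def, ← eval_map, map_cyclotomic]
    exact hroot
  exact ⟨(pb.lift θ haeval).toRingHom⟩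

end Reduction

end Summit.MatrixMultiplication.MatrixMultiplication.Theorems.LevelOneGL2Designs.HermitianLift
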